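import Mathlib
import Summits.MatrixMultiplication.MatrixMultiplication.Theorems.FourierTwoFamiliesModPPrimeCyclicPowerGainThetaOrbit

/-!
# The shape-count bound for the theta body of the frozen-difference conflict graph

Crux `stmt-MatrixMultiplication-14309` (`FourierTwoFamiliesModP.PrimeCyclicPowerGain`), line
`clique-coclique-direct-sum-clique`, milestone 2b of the bet `stub_thetaBound`; closes the registered milestone stub
`stub_thetaShapeCount`.

With the bet's vertex type `Finset (ZMod p) × Finset (ZMod p)` and its hypotheses verbatim (translation invariance,
symmetry, PSD, support on admissible equal-or-compatible pairs, trace `1`; nonnegativity and dominance are carried but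
not used): if the diagonal support of the kernel consists of translates of the block pairs in a finite set `SH` of
pairwise NON-translate "shapes", then `s² · Σ_{v,w} B v w ≤ |SH| · p`.  So a kernel carried by `K` shapes has value
`≤ K p / s²` — the single-shape case `K = 1` is the fractional form of the disprover's `translate_wall`, and a power
saving `value ≤ p s^{-1-c}` can only fail through `≥ s^{1-c}` distinct shapes carrying the kernel coherently.

Proof: the abstract orbit bound `…Orbit.stub_thetaOrbitBound` with clique transversal `T σ = σ.1 − σ.2` (the matched
difference set, of size `s²` by clause (W)): two distinct translates `t +ᵥ σ`, `t' +ᵥ σ` with `t, t' ∈ σ.1 − σ.2`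
conflict, because `t = (t − t') + t'` lies in `(t +ᵥ σ).1 − (t' +ᵥ σ).2` and in `σ.1 − σ.2 ⊆ X₀`; orbits of admissible
shapes are free since a nonempty proper subset of `ZMod p` has no period (`eq_univ_of_vadd_eq`).
-/

namespace Summit.MatrixMultiplication.MatrixMultiplication.Theorems.PrimeCyclicPowerGainTheta.ShapeCount

open scoped BigOperators Pointwise
open Summit.MatrixMultiplication.MatrixMultiplication.Theorems.PrimeCyclicPowerGainTheta

variable {p : ℕ} [Fact p.Prime]

/-- A nonempty finite subset of `ZMod p` (`p` prime) with a nonzero period is everything. -/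
theorem eq_univ_of_vadd_eq (A : Finset (ZMod p)) (hA : A.Nonempty) (t : ZMod p) (ht : t ≠ 0)
    (h : t +ᵥ A = A) : A = Finset.univ := by
  have hn : ∀ n : ℕ, (n • t) +ᵥ A = A := by
    intro n
    induction n with
    | zero => simp
    | succ n ih => rw [succ_nsmul, add_vadd, h, ih]
  have hall : ∀ u : ZMod p, u +ᵥ A = A := by
    intro u
    have hu : u = ((u * t⁻¹).val) • t := by
      rw [nsmul_eq_mul, ZMod.natCast_zmod_val, mul_assoc, inv_mul_cancel₀ ht, mul_one]
    rw [hu]; exact hn _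
  obtain ⟨a, ha⟩ := hA
  ext x
  simp only [Finset.mem_univ, iff_true]
  rw [← hall (x - a), Finset.mem_vadd_finset]
  exact ⟨a, ha, by rw [vadd_eq_add, sub_add_cancel]⟩

/-- Clause (W) makes the matched difference set of a block pair have `|A|·|B|` elements. -/
theorem card_sub_of_direct (v : Finset (ZMod p) × Finset (ZMod p))
    (hW : ∀ a ∈ v.1, ∀ a' ∈ v.1, ∀ b ∈ v.2, ∀ b' ∈ v.2, (a - a') + (b - b') = 0 → a = a' ∧ b = b') :
    (v.1 - v.2).card = v.1.card * v.2.card := by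
  rw [Finset.sub_def, ← Finset.card_product, Finset.card_image_iff]
  rintro ⟨a, b⟩ hab ⟨a', b'⟩ hab' h
  simp only [Finset.coe_product, Set.mem_prod, Finset.mem_coe] at hab hab'
  simp only at h
  have h0 : (a - a') + (b' - b) = 0 := by
    have e : (a - a') + (b' - b) = (a - b) - (a' - b') := by abel
    rw [e, h, sub_self]
  obtain ⟨e1, e2⟩ := hW a hab.1 a' hab'.1 b' hab'.2 b hab.2 h0
  rw [e1, e2]

/-- **Registered milestone stub `stub_thetaShapeCount`** (crux stmt-MatrixMultiplication-14309, line
clique-coclique-direct-sum-clique; milestone 2b of the bet `stub_thetaBound`).  With the bet's hypotheses verbatim: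
if every vertex on the diagonal support of the kernel is a translate of some block pair in `SH`, and the members of
`SH` are pairwise non-translates, then `s² · Σ_{v,w} B v w ≤ |SH| · p`. -/
theorem stub_thetaShapeCount :
    ∀ (p : ℕ) [Fact p.Prime] (s : ℕ), 1 ≤ s → ∀ (X₀ : Finset (ZMod p))
      (B : Finset (ZMod p) × Finset (ZMod p) → Finset (ZMod p) × Finset (ZMod p) → ℝ)
      (SH : Finset (Finset (ZMod p) × Finset (ZMod p))),
      (∀ (t : ZMod p) (v w : Finset (ZMod p) × Finset (ZMod p)), B (t +ᵥ v) (t +ᵥ w) = B v w) →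
      (∀ v w, B v w = B w v) →
      (∀ x : Finset (ZMod p) × Finset (ZMod p) → ℝ, 0 ≤ ∑ v, ∑ w, x v * B v w * x w) →
      (∀ v w, 0 ≤ B v w) →
      (∀ v w, B v w ≤ B v v) →
      (∀ v w : Finset (ZMod p) × Finset (ZMod p), B v w ≠ 0 →
        (v.1.card = s ∧ v.2.card = s ∧
          (∀ a ∈ v.1, ∀ a' ∈ v.1, ∀ b ∈ v.2, ∀ b' ∈ v.2, (a - a') + (b - b') = 0 → a = a' ∧ b = b') ∧
          v.1 - v.2 ⊆ X₀) ∧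
        (w.1.card = s ∧ w.2.card = s ∧
          (∀ a ∈ w.1, ∀ a' ∈ w.1, ∀ b ∈ w.2, ∀ b' ∈ w.2, (a - a') + (b - b') = 0 → a = a' ∧ b = b') ∧
          w.1 - w.2 ⊆ X₀) ∧
        (v = w ∨ (Disjoint (v.1 - w.2) X₀ ∧ Disjoint (w.1 - v.2) X₀))) →
      ∑ v, B v v = 1 →
      (∀ v, B v v ≠ 0 → ∃ σ ∈ SH, ∃ t : ZMod p, v = t +ᵥ σ) →
      (∀ σ ∈ SH, ∀ σ' ∈ SH, ∀ t : ZMod p, t +ᵥ σ = σ' → σ = σ') →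
      (s : ℝ) ^ 2 * ∑ v, ∑ w, B v w ≤ (SH.card : ℝ) * p := by
  intro p _ s hs X₀ B SH hinv hsymm hpsd _hnn _hdom hsupp htr hcover hdis
  have hprime : p.Prime := Fact.out
  -- restrict to the shapes that actually carry diagonal mass
  set SH' : Finset (Finset (ZMod p) × Finset (ZMod p)) := SH.filter (fun σ => B σ σ ≠ 0) with hSH'
  have hmem' : ∀ σ ∈ SH', σ ∈ SH ∧ B σ σ ≠ 0 := fun σ hσ => Finset.mem_filter.1 hσ
  -- admissibility data of a carried shape
  have hadm : ∀ σ ∈ SH', σ.1.card = s ∧ σ.2.card = s ∧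
      (∀ a ∈ σ.1, ∀ a' ∈ σ.1, ∀ b ∈ σ.2, ∀ b' ∈ σ.2, (a - a') + (b - b') = 0 → a = a' ∧ b = b') ∧
      σ.1 - σ.2 ⊆ X₀ := fun σ hσ => (hsupp σ σ (hmem' σ hσ).2).1
  have hcardD : ∀ σ ∈ SH', (σ.1 - σ.2).card = s * s := by
    intro σ hσ
    obtain ⟨h1, h2, hW, -⟩ := hadm σ hσ
    rw [card_sub_of_direct σ hW, h1, h2]
  -- s² ≤ p, hence s < p
  have hsp : ∀ σ ∈ SH', s < p := by
    intro σ hσ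
    have h1 : s * s ≤ p := by
      have := Finset.card_le_univ (σ.1 - σ.2)
      rw [hcardD σ hσ, ZMod.card] at this
      exact this
    rcases Nat.lt_or_ge s p with h | h
    · exact h
    · exfalso
      have h2 : p * p ≤ p := le_trans (Nat.mul_le_mul h h) h1
      have hp2 : 2 ≤ p := hprime.two_le
      nlinarith
  -- free orbits
  have hfree : ∀ σ ∈ SH', ∀ t : ZMod p, t +ᵥ σ = σ → t = 0 := by
    intro σ hσ t ht
    by_contra htne
    obtain ⟨h1, -, -, -⟩ := hadm σ hσ
    have hA : (t +ᵥ σ).1 = σ.1 := by rw [ht]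
    rw [Prod.vadd_fst] at hA
    have hne : σ.1.Nonempty := by rw [← Finset.card_pos, h1]; exact hs
    have huniv := eq_univ_of_vadd_eq σ.1 hne t htne hA
    have : s = p := by rw [← h1, huniv, Finset.card_univ, ZMod.card]
    exact absurd this (ne_of_lt (hsp σ hσ))
  -- clique transversal T σ := σ.1 - σ.2
  have hclique : ∀ σ ∈ SH', ∀ t ∈ σ.1 - σ.2, ∀ t' ∈ σ.1 - σ.2, t ≠ t' →
      B (t +ᵥ σ) (t' +ᵥ σ) = 0 := by
    intro σ hσ t ht t' ht' htt'
    by_contra hB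
    obtain ⟨-, -, hcomp⟩ := hsupp _ _ hB
    obtain ⟨-, -, -, hD⟩ := hadm σ hσ
    rcases hcomp with heq | ⟨hdis1, -⟩
    · -- equal translates would give a period `t - t'`
      have h1 : (-t' + t) +ᵥ σ = σ := by rw [← vadd_vadd, heq, neg_vadd_vadd]
      have h2 := hfree σ hσ _ h1
      apply htt'
      have := congrArg (fun u => t' + u) h2
      simpa using this
    · -- `t = (t - t') + t'` lies in `(t +ᵥ σ).1 - (t' +ᵥ σ).2` and in `X₀`
      have htX : t ∈ X₀ := hD ht
      rw [Finset.mem_sub] at ht'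
      obtain ⟨a, ha, b, hb, hab⟩ := ht'
      have hmem : t ∈ (t +ᵥ σ).1 - (t' +ᵥ σ).2 := by
        rw [Prod.vadd_fst, Prod.vadd_snd, Finset.mem_sub]
        refine ⟨t +ᵥ a, Finset.vadd_mem_vadd_finset_iff t |>.2 ha, t' +ᵥ b,
          Finset.vadd_mem_vadd_finset_iff t' |>.2 hb, ?_⟩
        simp only [vadd_eq_add]
        rw [← hab]; abel
      exact Finset.disjoint_left.1 hdis1 hmem htX
  -- cover by SH'
  have hcover' : ∀ v, B v v ≠ 0 → ∃ σ ∈ SH', ∃ t : ZMod p, v = t +ᵥ σ := by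
    intro v hv
    obtain ⟨σ, hσ, t, rfl⟩ := hcover v hv
    refine ⟨σ, Finset.mem_filter.2 ⟨hσ, ?_⟩, t, rfl⟩
    rwa [hinv t σ σ] at hv
  have hdis' : ∀ σ ∈ SH', ∀ σ' ∈ SH', ∀ t : ZMod p, t +ᵥ σ = σ' → σ = σ' :=
    fun σ hσ σ' hσ' t h => hdis σ (hmem' σ hσ).1 σ' (hmem' σ' hσ').1 t h
  -- the abstract orbit bound
  have key := Orbit.stub_thetaOrbitBound p (Finset (ZMod p) × Finset (ZMod p)) B SH'
    (fun σ => σ.1 - σ.2) (s * s) hinv hsymm hpsd htr hcover' hdis' hfree hcardD hclique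
  have hK : (SH'.card : ℝ) ≤ SH.card := by exact_mod_cast Finset.card_filter_le _ _
  have hp0 : (0 : ℝ) ≤ p := Nat.cast_nonneg _
  calc (s : ℝ) ^ 2 * ∑ v, ∑ w, B v w = ((s * s : ℕ) : ℝ) * ∑ v, ∑ w, B v w := by push_cast; ring
    _ ≤ (SH'.card : ℝ) * p := key
    _ ≤ (SH.card : ℝ) * p := mul_le_mul_of_nonneg_right hK hp0

end Summit.MatrixMultiplication.MatrixMultiplication.Theorems.PrimeCyclicPowerGainTheta.ShapeCount
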